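import Summits.QuantumFields.YangMills.Theorems.BalabanUVNodesPortS1Assembly
import Summits.QuantumFields.YangMills.Theorems.BalabanUVNodesPortS1UnitSubtraction

/-!
# NODE O port PT-A — LOCATED: PULL-BACK PIECES ARE BLIND TO FLAT BACKGROUNDS, so the residue form's (f′) row (ONE integer formula for ALL domains, wrapping ones
# included) forces `Φf(B) = Φf(0)` at every `B` whose background `U_{k+1}(W_B)` is gauge-equivalent to a constant-direction (flat, abelian) field — a constraint print does NOT
# impose ([I] (1.7): the pieces of WRAPPING domains are functions on the torus and carry the holonomy dependence; (1.21) ties across volumes only the NON-wrapping ones)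

Cell `ym-nodeO-ideate`, porter seat `ymgap-nodeO-port-PTA-1` (gen 3); `--supports stmt-QuantumFields-27930` (helper; a LOCATED finding about the LINE's intermediate target — the
residue form of `…PortS1Assembly.formatPlusG_recordJ_of_intLocalResidue` ∕ `…PortS1Residue` ∕ DEF-1 ed.13 `IntFormula.Represents` — NOT about the signed text 27930⁸-Ax-LR4, whose
`FormatPlusG` leaves the pieces of the wrap class `recordWrapCtr` free per volume).  [I] = [Balaban1987RG1].

THE MECHANISM (kernel, below).  A window-local (LOC), `SL(2,ℂ)`-gauge-invariant (GI) integer formula `Ψ` reads the pull-back `φ ∘ cover` of a pair on the torus through the universal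
cover `ℤ⁴ → T_K`.  A FLAT torus field — here the constant-direction field `U(b) = g` for `b.dir = μ₀`, `1` otherwise, `g ∈ SU(2)` (all plaquette variables `= 1`, current (1.8) `= 0`,
Polyakov loop in direction `μ₀` = `g^{N}` ≠ 1) — pulls back to a PURE GAUGE on `ℤ⁴`: `U ∘ cover = (𝟙)^{û}` with `û(z) = (g⁻¹)^{z_{μ₀}}` (single-valued on `ℤ⁴`, NOT on the torus).
Hence by (LOC)+(GI) every pull-back piece takes at `(U, J(U)) cut to X` the SAME value as at the unit pair — for EVERY domain `X`, wrapping or not (§2–§3).  So the residue's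
right-hand side `Σ_X Ψ(X̂_K(X))((U_{k+1}(W_B), J(U_{k+1}(W_B))) cut to X ∘ cover)` is blind to the holonomy of flat backgrounds, and its (f′) row forces the represented
functional to satisfy `Φf n B = Φf n 0` whenever `U_{k+1}(W_B)` is `SU(2)`-gauge-equivalent on the torus to such a field (§4; torus-gauge blindness is `…PortS1Assembly` §2).

WHY IT MATTERS (located, for CRIT-1 ∕ DEF-1 ∕ port-lead; no ruling asked of the kernel).  At the record, `W^θ := unitField B_θ` with `B_θ` = `θ` on the `μ₀`-bonds (colour 3), `0`
elsewhere, is flat with Polyakov angle `∝ θ`, `B_θ → 0`; its fine minimiser is the flat field `g = exp(iθ′σ₃)`, `θ′ = θ∕L^{k+1}` (zero Wilson action, block averages `= W^θ`), so under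
TokE's `UniqueUkOrbit` the rooted `recordBgField B_θ` is gauge-equivalent to it and §4 gives `recordΦfAx(B_θ) = recordΦfAx(0)` for all small `θ` from the residue form — i.e. the
one-step effective action would be EXACTLY independent of the holonomy of flat coarse fields.  Print claims no such thing: the `θ`-dependence (a finite-volume, twisted-boundary
effect of the fluctuation integral) sits in the pieces of the WRAPPING domains, bounded by `E₀e^{−κ d(X)}` with `d(X) ≳` the torus size — small, not zero.  REPAIR (next file):
the wrap-aware residue — ONE integer formula for `X ∉ recordWrapCtr n` (these lie in the contractible centred window, where pull-backs lose nothing), FREE torus-level pieces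
with rows (a)(b)(c)(d) for `X ∈ recordWrapCtr n` — exactly the freedom the signed `FormatPlusG` ∕ `PieceVolIndep` already grant.

CONTENTS.  §1 the constant-direction field is flat: `plaqU_constDir`, `imPlaq_constDir`, ★ `current_constDir` (`J = 0`).  §2 ★★ `formula_cut_eq_unit_of_coverExact` — (LOC)+(GI): a pair
whose pull-back is `û`-exact with zero current on the window of `X̂` gives `Ψ(X̂)(cut pair ∘ cover) = Ψ(X̂)(𝟙)`.  §3 ★★ `formula_cut_constDir_eq_unit` — the constant-direction field
is cover-exact (`û(z) = (g⁻¹)^{z_{μ₀}}`), so every pull-back piece of `(U, J(U))` is its value at `𝟙`, at EVERY domain.  §4 ★★★ `represents_forces_flatBlind` — if `Ψ` represents `Φf`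
(DEF-1 `IntFormula.Represents`), then eventually near `B = 0`: `U_{k+1}(W_B)` torus-gauge-equivalent to a constant-direction field ⟹ `Φf n B = Φf n 0`.

HONEST FRAMING.  Kernel lemmas about integer formulas + a located reading; NO claim that 27930 is false (it is not hit), NO value of the record's functional computed (that the
holonomy dependence of `recordΦfAx` along `W^θ` is non-zero is print-consistent physics, not a tree theorem — so the residue form is called MIS-SPECIFIED, not refuted); 27930
OPEN; K0⁷ NOT closed; NODE O 0∕1; COUNT 8∕28 · K 1∕4 UNMOVED; finite `𝕋⁴_{L^K}` at fixed ε — NOT continuum ∕ OS ∕ Clay; **the Yang–Mills mass gap is NOT proved by any of this.**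
No `sorry`, no `def`, no `instance`; standard axioms.
-/

noncomputable section

open scoped BigOperators Matrix.Norms.L2Operator Topology

namespace Summit.QuantumFields.YangMills.Theorems.BalabanUVNodesPortS1

open Summit.QuantumFields.YangMills.Theorems.K0RecordFormatNames
open Literature.MathematicalPhysics.QuantumFieldTheory.Balaban1983to89
open Literature.MathematicalPhysics.QuantumFieldTheory.Balaban1983to89.Node00
open Literature.MathematicalPhysics.QuantumFieldTheory.Balaban1983to89.T4Continuum (T4Family)
open Literature.MathematicalPhysics.QuantumFieldTheory.Balaban1983to89.B15Eq112TorusCover (cover)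
open Literature.MathematicalPhysics.QuantumFieldTheory.Balaban1983to89.B14.Eq213MaximalDomains (cubeExt)
open _root_.Filter

variable (F : T4Family)

/-! ## §1  The constant-direction field is flat: plaquettes `= 1`, current `= 0` -/

/-- **Every plaquette variable of a constant-direction field is `1`** (`U(b) = g` on the `μ₀`-bonds, `1` on the others: `g·1·g⁻¹·1`, `1·g·1·g⁻¹`, `g·g·g⁻¹·g⁻¹`, `1`).
[cite: Balaban1987RG1, (1.8) p.261; Balaban1985BackgroundPropagators, (3.2) p.390 (plaquette variables; bookkeeping)] -/
theorem plaqU_constDir {P : Params} {i : ℕ} (μ₀ : Fin P.d) (g : (MatA 2)ˣ) (U : PBond P i → (MatA 2)ˣ)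
    (hg : ∀ b : PBond P i, b.dir = μ₀ → U b = g) (h1 : ∀ b : PBond P i, b.dir ≠ μ₀ → U b = 1) (μ ν : Fin P.d) (x : Site P i) :
    B9Eq39Adjoint.plaqU (B9TorusCalculus.torusT P i) (B12Eq18Current.dirForm U) μ ν x = 1 := by
  simp only [B9Eq39Adjoint.plaqU, B12Eq18Current.dirForm]
  by_cases hμ : μ = μ₀
  · by_cases hν : ν = μ₀
    · rw [hg ⟨x, μ⟩ hμ, hg ⟨_, ν⟩ hν, hg ⟨_, μ⟩ hμ, hg ⟨x, ν⟩ hν]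
      group
    · rw [hg ⟨x, μ⟩ hμ, h1 ⟨_, ν⟩ hν, hg ⟨_, μ⟩ hμ, h1 ⟨x, ν⟩ hν]
      group
  · by_cases hν : ν = μ₀
    · rw [h1 ⟨x, μ⟩ hμ, hg ⟨_, ν⟩ hν, h1 ⟨_, μ⟩ hμ, hg ⟨x, ν⟩ hν]
      group
    · rw [h1 ⟨x, μ⟩ hμ, h1 ⟨_, ν⟩ hν, h1 ⟨_, μ⟩ hμ, h1 ⟨x, ν⟩ hν]
      group

/-- The plaquette function `ξ⁻² π Im ∂U` of a constant-direction field vanishes. [cite: Balaban1987RG1, (1.8) p.261] -/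
theorem imPlaq_constDir {P : Params} {i : ℕ} (π : MatA 2 →ₗ[ℂ] MatA 2) (ξ : ℝ) (μ₀ : Fin P.d) (g : (MatA 2)ˣ) (U : PBond P i → (MatA 2)ˣ)
    (hg : ∀ b : PBond P i, b.dir = μ₀ → U b = g) (h1 : ∀ b : PBond P i, b.dir ≠ μ₀ → U b = 1) :
    B12Eq18Current.imPlaq π ξ U = fun _ _ _ => 0 := by
  funext μ ν x
  simp only [B12Eq18Current.imPlaq, plaqU_constDir μ₀ g U hg h1 μ ν x, B9Eq37Insertion.imC_one, map_zero, smul_zero]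

/-- ★ **The current (1.8) of a constant-direction field vanishes**: `J(U) = D^{ξ*} ξ⁻² π Im ∂U = 0` — a FLAT field carries no current. [cite: Balaban1987RG1, (1.8) p.261] -/
theorem current_constDir {P : Params} {i : ℕ} (π : MatA 2 →ₗ[ℂ] MatA 2) (ξ : ℝ) (μ₀ : Fin P.d) (g : (MatA 2)ˣ) (U : PBond P i → (MatA 2)ˣ)
    (hg : ∀ b : PBond P i, b.dir = μ₀ → U b = g) (h1 : ∀ b : PBond P i, b.dir ≠ μ₀ → U b = 1) :
    B12Eq18Current.current π ξ U = 0 := by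
  funext b
  rw [B12Eq18Current.current_apply, imPlaq_constDir π ξ μ₀ g U hg h1]
  simp [B9Eq39Adjoint.divP, B9Eq39Adjoint.covDstar, B9Eq39Adjoint.R]

/-! ## §2  ★★ (LOC)+(GI): pull-back pieces are blind to cover-exact pairs -/

variable {F} in
open scoped Classical in
/-- ★★ **A COVER-EXACT PAIR LOOKS LIKE THE UNIT PAIR TO EVERY PULL-BACK PIECE.**  Exactly tiled range; `Ψ` window-local and `SL(2,ℂ)`-invariant (the residue's raw binders); a pair `φ`
on `T_K` whose first component is `û`-EXACT along the cover on the window of `X̂_K(X)` — `φ.1(cover z, ν) = û(z)·û(z + e_ν)⁻¹` for window bonds, `û : ℤ⁴ → SL(2,ℂ)` single-valued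
on `ℤ⁴` (no periodicity asked!) — and whose second component vanishes there.  Then `Ψ(X̂)((φ cut to X) ∘ cover) = Ψ(X̂)(𝟙)`: on the window the cut is the identity and the pull-back
IS `𝟙^{û}` ((LOC)), and `Ψ(X̂)(𝟙^{û}) = Ψ(X̂)(𝟙)` ((GI)). [cite: Balaban1987RG1, (1.7) p.261, (1.10) p.262, (1.19) p.263] -/
theorem formula_cut_eq_unit_of_coverExact {Mc k K : ℕ} (hMc : McGuard F Mc) (hK : recordK₀ F Mc k ≤ K)
    (Ψ : IntFormula) (hΨloc : Ψ.IsLocal (F.L ^ (k + 1) * Mc)) (hΨG : Ψ.IsGaugeInv)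
    (X : (recordDomSys F Mc k K).Dom) (φ : Sect2.CPair (F.P K) (MatA 2))
    (û : (Fin 4 → ℤ) → (MatA 2)ˣ) (hû : ∀ z, û z ∈ (B12RegularSpaces111SpecialUnitary.suModel 2).Gc)
    (hφ1 : ∀ (z : Fin 4 → ℤ) (ν : Fin 4), z ∈ intSites (F.L ^ (k + 1) * Mc) (intCubes F Mc k K X) →
      Function.update z ν (z ν + 1) ∈ intSites (F.L ^ (k + 1) * Mc) (intCubes F Mc k K X) →
        φ.1 ⟨cover (F.P K) z, ν⟩ = (û z : MatA 2) * ((û (Function.update z ν (z ν + 1)))⁻¹ : (MatA 2)ˣ))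
    (hφ2 : ∀ (z : Fin 4 → ℤ) (ν : Fin 4), z ∈ intSites (F.L ^ (k + 1) * Mc) (intCubes F Mc k K X) →
      Function.update z ν (z ν + 1) ∈ intSites (F.L ^ (k + 1) * Mc) (intCubes F Mc k K X) → φ.2 ⟨cover (F.P K) z, ν⟩ = 0) :
    Ψ (intCubes F Mc k K X)
        (fun zμ => ((if (⟨cover (F.P K) zμ.1, zμ.2⟩ : PBond (F.P K) 0) ∈ domBonds F Mc k K X then φ.1 ⟨cover (F.P K) zμ.1, zμ.2⟩ else 1),
                    (if (⟨cover (F.P K) zμ.1, zμ.2⟩ : PBond (F.P K) 0) ∈ domBonds F Mc k K X then φ.2 ⟨cover (F.P K) zμ.1, zμ.2⟩ else 0))) =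
      Ψ (intCubes F Mc k K X) (fun _ => ((1 : MatA 2), (0 : MatA 2))) := by
  -- (LOC): on the window the cut pair IS the gauge transform of the unit configuration by `û`
  have step1 : Ψ (intCubes F Mc k K X)
      (fun zμ => ((if (⟨cover (F.P K) zμ.1, zμ.2⟩ : PBond (F.P K) 0) ∈ domBonds F Mc k K X then φ.1 ⟨cover (F.P K) zμ.1, zμ.2⟩ else 1),
                  (if (⟨cover (F.P K) zμ.1, zμ.2⟩ : PBond (F.P K) 0) ∈ domBonds F Mc k K X then φ.2 ⟨cover (F.P K) zμ.1, zμ.2⟩ else 0))) =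
      Ψ (intCubes F Mc k K X) (intGaugeAct û (fun _ => ((1 : MatA 2), (0 : MatA 2)))) := by
    refine hΨloc _ _ _ fun zμ hz hzt => ?_
    -- the bond lies in `X`
    have hz' := hz; have hzt' := hzt
    simp only [intCubes] at hz' hzt'
    obtain ⟨a, ha, hza⟩ := Set.mem_iUnion₂.1 hz'
    obtain ⟨a', ha', hza'⟩ := Set.mem_iUnion₂.1 hzt'
    obtain ⟨c, hc, rfl⟩ := Finset.mem_image.1 ha
    obtain ⟨c', hc', rfl⟩ := Finset.mem_image.1 ha'
    have h1 : cover (F.P K) zμ.1 ∈ Sect2.domSites (F.P K) Mc (k + 1) X := cover_mem_domSites_of_mem_cubeExt_valMinAbs hMc hK hc hza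
    have h2 : (⟨cover (F.P K) zμ.1, zμ.2⟩ : PBond (F.P K) 0).tgt ∈ Sect2.domSites (F.P K) Mc (k + 1) X := by
      rw [tgt_cover]
      exact cover_mem_domSites_of_mem_cubeExt_valMinAbs hMc hK hc' hza'
    have hb : (⟨cover (F.P K) zμ.1, zμ.2⟩ : PBond (F.P K) 0) ∈ domBonds F Mc k K X := ⟨h1, h2⟩
    simp only [if_pos hb, intGaugeAct, mul_one, mul_zero, zero_mul]
    exact Prod.ext (hφ1 zμ.1 zμ.2 hz hzt) (hφ2 zμ.1 zμ.2 hz hzt)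
  -- (GI)
  exact step1.trans (hΨG _ û hû _)

/-! ## §3  ★★ The constant-direction field is cover-exact: every pull-back piece of `(U, J(U))` is its value at `𝟙` -/

/-- **The integer gauge function of the constant-direction field**: `û(z) = h^{z_{μ₀}}` satisfies `û(z)·û(z + e_ν)⁻¹ = h⁻¹` for `ν = μ₀` and `= 1` otherwise.
[cite: Balaban1987RG1, (1.10) p.262 (bookkeeping)] -/
theorem zpow_mul_zpow_update_inv (h : (MatA 2)ˣ) (μ₀ : Fin 4) (z : Fin 4 → ℤ) (ν : Fin 4) :
    h ^ (z μ₀) * (h ^ ((Function.update z ν (z ν + 1)) μ₀))⁻¹ = if ν = μ₀ then h⁻¹ else 1 := by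
  by_cases hν : ν = μ₀
  · subst hν
    rw [if_pos rfl, Function.update_self, zpow_add_one]
    group
  · rw [if_neg hν, Function.update_of_ne (Ne.symm hν), mul_inv_cancel]

variable {F} in
open scoped Classical in
/-- ★★ **EVERY PULL-BACK PIECE OF A CONSTANT-DIRECTION FIELD IS ITS VALUE AT THE UNIT PAIR** — at EVERY domain `X` of EVERY volume of the exactly tiled range, wrapping or not:
for `U(b) = g` (`b.dir = μ₀`), `1` otherwise, `g ∈ SU(2)`: `Ψ(X̂)(((U, J_ξ(U)) cut to X) ∘ cover) = Ψ(X̂)(𝟙)`.  (The pull-back of `U` is `𝟙^{û}`, `û(z) = (g⁻¹)^{z_{μ₀}} ∈ SU(2) ⊆ SL(2,ℂ)`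
single-valued on `ℤ⁴`; the current vanishes by §1.)  The Polyakov loop `g^N` of `U` is invisible. [cite: Balaban1987RG1, (1.7) p.261, (1.10) p.262, (1.19) p.263, (1.21) p.264] -/
theorem formula_cut_constDir_eq_unit {Mc k K : ℕ} (hMc : McGuard F Mc) (hK : recordK₀ F Mc k ≤ K)
    (Ψ : IntFormula) (hΨloc : Ψ.IsLocal (F.L ^ (k + 1) * Mc)) (hΨG : Ψ.IsGaugeInv)
    (X : (recordDomSys F Mc k K).Dom) (μ₀ : Fin (F.P K).d) (g : SU 2) (U : GaugeField (F.P K) 0 (SU 2))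
    (hg : ∀ b : PBond (F.P K) 0, b.dir = μ₀ → U b = g) (h1 : ∀ b : PBond (F.P K) 0, b.dir ≠ μ₀ → U b = 1) (ξ : ℝ) :
    Ψ (intCubes F Mc k K X)
        (fun zμ => ((if (⟨cover (F.P K) zμ.1, zμ.2⟩ : PBond (F.P K) 0) ∈ domBonds F Mc k K X then ((U ⟨cover (F.P K) zμ.1, zμ.2⟩ : SU 2) : MatA 2) else 1),
                    (if (⟨cover (F.P K) zμ.1, zμ.2⟩ : PBond (F.P K) 0) ∈ domBonds F Mc k K X then
                        B12Eq18Current.current sl2Proj ξ (fun b => ιSU 2 (U b)) ⟨cover (F.P K) zμ.1, zμ.2⟩ else 0))) =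
      Ψ (intCubes F Mc k K X) (fun _ => ((1 : MatA 2), (0 : MatA 2))) := by
  -- the units-valued field and its current
  have hgU : ∀ b : PBond (F.P K) 0, b.dir = μ₀ → (fun b => ιSU 2 (U b)) b = ιSU 2 g := fun b hb => by simp only [hg b hb]
  have h1U : ∀ b : PBond (F.P K) 0, b.dir ≠ μ₀ → (fun b => ιSU 2 (U b)) b = 1 := fun b hb => by simp only [h1 b hb, map_one]
  have hJ : B12Eq18Current.current sl2Proj ξ (fun b => ιSU 2 (U b)) = 0 := current_constDir sl2Proj ξ μ₀ (ιSU 2 g) _ hgU h1U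
  -- the integer gauge function
  refine formula_cut_eq_unit_of_coverExact hMc hK Ψ hΨloc hΨG X
    ((fun b => ((U b : SU 2) : MatA 2)), B12Eq18Current.current sl2Proj ξ (fun b => ιSU 2 (U b)))
    (fun z => (ιSU 2 g)⁻¹ ^ (z μ₀)) (fun z => ?_) (fun z ν _ _ => ?_) (fun z ν _ _ => ?_)
  · exact Subgroup.zpow_mem _ (Subgroup.inv_mem _ (B12RegularSpaces111SpecialUnitary.suModel_G_le_Gc (ιSU_mem_G 2 g))) _
  · show ((U ⟨cover (F.P K) z, ν⟩ : SU 2) : MatA 2) = _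
    rw [← Units.val_mul, zpow_mul_zpow_update_inv, inv_inv]
    by_cases hν : ν = μ₀
    · rw [if_pos hν, hg ⟨cover (F.P K) z, ν⟩ hν, coe_ιSU]
    · rw [if_neg hν, h1 ⟨cover (F.P K) z, ν⟩ hν]
      simp
  · show B12Eq18Current.current sl2Proj ξ (fun b => ιSU 2 (U b)) ⟨cover (F.P K) z, ν⟩ = 0
    rw [hJ]
    rfl

/-! ## §4  ★★★ The residue's (f′) row forces blindness to flat backgrounds -/

variable {F} in
open scoped Classical in
/-- **The (f′) right-hand side at a background gauge-equivalent to a constant-direction field equals its value at the unit pair.**  If the rooted background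
`U_{k+1}(W_B)` is `SU(2)`-gauge-equivalent on the torus to a constant-direction field, then `Σ_X Ψ(X̂)(pairCutAt X B) = Σ_X Ψ(X̂)(𝟙)` (torus-gauge blindness `…PortS1Assembly` §2 + §3).
[cite: Balaban1987RG1, (1.7) p.261, (1.10) p.262, (1.19) p.263] -/
theorem sum_formula_pairCutAt_eq_sum_unit_of_gaugeEq_constDir {Mc k : ℕ} (hMc : McGuard F Mc) (a₀ ε₂₉ : ℝ) (n : ℕ)
    (Ψ : IntFormula) (hΨloc : Ψ.IsLocal (F.L ^ (k + 1) * Mc)) (hΨG : Ψ.IsGaugeInv)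
    (B : recordW F a₀ ε₂₉ k (recordK₀ F Mc k + n))
    (μ₀ : Fin (F.P (recordK₀ F Mc k + n)).d) (g : SU 2) (U : GaugeField (F.P (recordK₀ F Mc k + n)) 0 (SU 2))
    (hg : ∀ b, b.dir = μ₀ → U b = g) (h1 : ∀ b, b.dir ≠ μ₀ → U b = 1)
    (u : GaugeTransf (F.P (recordK₀ F Mc k + n)) 0 (SU 2))
    (hB : letI θ := thetaFill F a₀ ε₂₉; letI := θ.instVβ₁; letI := θ.instVβ₂; letI := θ.instιβ
      recordBgField F θ k (recordK₀ F Mc k + n) B = GaugeField.gaugeAct u U) :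
    ∑ X : (recordDomSys F Mc k (recordK₀ F Mc k + n)).Dom, Ψ (intCubes F Mc k (recordK₀ F Mc k + n) X) (pairCutAt F a₀ ε₂₉ Mc k (recordK₀ F Mc k + n) X B) =
      ∑ X : (recordDomSys F Mc k (recordK₀ F Mc k + n)).Dom, Ψ (intCubes F Mc k (recordK₀ F Mc k + n) X) (fun _ => ((1 : MatA 2), (0 : MatA 2))) := by
  letI θ := thetaFill F a₀ ε₂₉; letI := θ.instVβ₁; letI := θ.instVβ₂; letI := θ.instιβ
  refine Finset.sum_congr rfl fun X _ => ?_
  have hK : recordK₀ F Mc k ≤ recordK₀ F Mc k + n := Nat.le_add_right _ _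
  -- the (f′) integrand is the cut pair of `(U_{k+1}(W_B), J(U_{k+1}(W_B)))` read at the rooted field; rewrite the rooted field as the gauge transform of `U`
  have hpair : (((fun b => ((recordBgField F θ k (recordK₀ F Mc k + n) B b : SU 2) : MatA 2)),
        recordCurrent F θ k (recordK₀ F Mc k + n) B) : Sect2.CPair (F.P (recordK₀ F Mc k + n)) (MatA 2)) =
      Sect2.cAct (fun x => ιSU 2 (u x))
        ((fun b => ((U b : SU 2) : MatA 2)), B12Eq18Current.current sl2Proj ((F.P (recordK₀ F Mc k + n)).eta (k + 1)) (fun b => ιSU 2 (U b))) := by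
    have := pairOf_gaugeAct F (recordK₀ F Mc k + n) ((F.P (recordK₀ F Mc k + n)).eta (k + 1)) u U
    rw [← hB] at this
    exact this
  have step0 : Ψ (intCubes F Mc k (recordK₀ F Mc k + n) X) (pairCutAt F a₀ ε₂₉ Mc k (recordK₀ F Mc k + n) X B) =
      Ψ (intCubes F Mc k (recordK₀ F Mc k + n) X)
        (fun zμ => ((if (⟨cover (F.P _) zμ.1, zμ.2⟩ : PBond (F.P (recordK₀ F Mc k + n)) 0) ∈ domBonds F Mc k (recordK₀ F Mc k + n) X then
                        (Sect2.cAct (fun x => ιSU 2 (u x))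
                          ((fun b => ((U b : SU 2) : MatA 2)), B12Eq18Current.current sl2Proj ((F.P (recordK₀ F Mc k + n)).eta (k + 1)) (fun b => ιSU 2 (U b)))).1
                          ⟨cover (F.P _) zμ.1, zμ.2⟩ else 1),
                    (if (⟨cover (F.P _) zμ.1, zμ.2⟩ : PBond (F.P (recordK₀ F Mc k + n)) 0) ∈ domBonds F Mc k (recordK₀ F Mc k + n) X then
                        (Sect2.cAct (fun x => ιSU 2 (u x))
                          ((fun b => ((U b : SU 2) : MatA 2)), B12Eq18Current.current sl2Proj ((F.P (recordK₀ F Mc k + n)).eta (k + 1)) (fun b => ιSU 2 (U b)))).2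
                          ⟨cover (F.P _) zμ.1, zμ.2⟩ else 0))) := by
    rw [← hpair]
    rfl
  rw [step0]
  -- torus-gauge blindness of the cut piece (`…PortS1Assembly` §2), then §3
  have hu : ∀ x, (fun x => ιSU 2 (u x)) x ∈ (B12RegularSpaces111SpecialUnitary.suModel 2).Gc :=
    fun x => B12RegularSpaces111SpecialUnitary.suModel_G_le_Gc (ιSU_mem_G 2 (u x))
  have key : Ψ (intCubes F Mc k (recordK₀ F Mc k + n) X)
        (fun zμ => ((if (⟨cover (F.P _) zμ.1, zμ.2⟩ : PBond (F.P (recordK₀ F Mc k + n)) 0) ∈ domBonds F Mc k (recordK₀ F Mc k + n) X then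
                        (Sect2.cAct (fun x => ιSU 2 (u x))
                          ((fun b => ((U b : SU 2) : MatA 2)), B12Eq18Current.current sl2Proj ((F.P (recordK₀ F Mc k + n)).eta (k + 1)) (fun b => ιSU 2 (U b)))).1
                          ⟨cover (F.P _) zμ.1, zμ.2⟩ else 1),
                    (if (⟨cover (F.P _) zμ.1, zμ.2⟩ : PBond (F.P (recordK₀ F Mc k + n)) 0) ∈ domBonds F Mc k (recordK₀ F Mc k + n) X then
                        (Sect2.cAct (fun x => ιSU 2 (u x))
                          ((fun b => ((U b : SU 2) : MatA 2)), B12Eq18Current.current sl2Proj ((F.P (recordK₀ F Mc k + n)).eta (k + 1)) (fun b => ιSU 2 (U b)))).2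
                          ⟨cover (F.P _) zμ.1, zμ.2⟩ else 0))) =
      Ψ (intCubes F Mc k (recordK₀ F Mc k + n) X)
        (fun zμ => ((if (⟨cover (F.P _) zμ.1, zμ.2⟩ : PBond (F.P (recordK₀ F Mc k + n)) 0) ∈ domBonds F Mc k (recordK₀ F Mc k + n) X then
                        ((U ⟨cover (F.P _) zμ.1, zμ.2⟩ : SU 2) : MatA 2) else 1),
                    (if (⟨cover (F.P _) zμ.1, zμ.2⟩ : PBond (F.P (recordK₀ F Mc k + n)) 0) ∈ domBonds F Mc k (recordK₀ F Mc k + n) X then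
                        B12Eq18Current.current sl2Proj ((F.P (recordK₀ F Mc k + n)).eta (k + 1)) (fun b => ιSU 2 (U b)) ⟨cover (F.P _) zμ.1, zμ.2⟩ else 0))) :=
    piece_pairCut_cAct hMc hK Ψ hΨloc hΨG X ⟨fun x => ιSU 2 (u x), hu⟩
      ((fun b => ((U b : SU 2) : MatA 2)), B12Eq18Current.current sl2Proj ((F.P (recordK₀ F Mc k + n)).eta (k + 1)) (fun b => ιSU 2 (U b)))
  rw [key]
  exact formula_cut_constDir_eq_unit hMc hK Ψ hΨloc hΨG X μ₀ g U hg h1 _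

variable {F} in
open scoped Classical in
/-- ★★★ **THE RESIDUE's (f′) ROW FORCES BLINDNESS TO FLAT BACKGROUNDS.**  If a window-local `SL(2,ℂ)`-invariant `Ψ` REPRESENTS the family `Φf` (DEF-1 `IntFormula.Represents`:
`Φf n B = Σ_X Ψ(X̂)(pairCutAt X B)` eventually at `B = 0`, ALL domains `X`), then eventually near `B = 0`: whenever the rooted background `U_{k+1}(W_B)` is `SU(2)`-gauge-equivalent to a
constant-direction (flat) field, `Φf n B = Φf n 0`.  At the record (`Φf := recordΦfAx …`) this says the one-step effective action is EXACTLY constant along the flat abelian coarse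
fields `W^θ` — a constraint print's (1.7) does not impose (wrapping pieces are torus functions).  LOCATED; the repair is the wrap-aware residue.
[cite: Balaban1987RG1, (1.6)–(1.7) p.261, (1.19) p.263, (1.21) p.264] -/
theorem represents_forces_flatBlind {Mc k : ℕ} (hMc : McGuard F Mc) (a₀ ε₂₉ : ℝ)
    (Ψ : IntFormula) (hΨloc : Ψ.IsLocal (F.L ^ (k + 1) * Mc)) (hΨG : Ψ.IsGaugeInv)
    (Φf : (n : ℕ) → recordW F a₀ ε₂₉ k (recordK₀ F Mc k + n) → ℂ) (hR : Ψ.Represents F a₀ ε₂₉ Mc k Φf) (n : ℕ) :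
    letI θ := thetaFill F a₀ ε₂₉; letI := θ.instVβ₁; letI := θ.instVβ₂; letI := θ.instιβ
    ∀ᶠ B in 𝓝 (0 : recordW F a₀ ε₂₉ k (recordK₀ F Mc k + n)),
      (∃ (μ₀ : Fin (F.P (recordK₀ F Mc k + n)).d) (g : SU 2) (U : GaugeField (F.P (recordK₀ F Mc k + n)) 0 (SU 2))
          (u : GaugeTransf (F.P (recordK₀ F Mc k + n)) 0 (SU 2)),
          (∀ b, b.dir = μ₀ → U b = g) ∧ (∀ b, b.dir ≠ μ₀ → U b = 1) ∧ recordBgField F θ k (recordK₀ F Mc k + n) B = GaugeField.gaugeAct u U) →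
        Φf n B = Φf n 0 := by
  letI θ := thetaFill F a₀ ε₂₉; letI := θ.instVβ₁; letI := θ.instVβ₂; letI := θ.instιβ
  rw [IntFormula.represents_iff] at hR
  have h0 := (hR n).self_of_nhds
  filter_upwards [hR n] with B hB
  rintro ⟨μ₀, g, U, u, hg, h1, hBU⟩
  rw [hB, h0, sum_formula_pairCutAt_eq_sum_unit_of_gaugeEq_constDir hMc a₀ ε₂₉ n Ψ hΨloc hΨG B μ₀ g U hg h1 u hBU]
  refine Finset.sum_congr rfl fun X _ => ?_
  rw [pairCutAt_zero F a₀ ε₂₉ Mc k n X]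

end Summit.QuantumFields.YangMills.Theorems.BalabanUVNodesPortS1

end
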